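import Literature.NumberTheory.LFunctions.HalaszRestrictedOffMinimiser
import Literature.NumberTheory.Sieve.MatomakiRadziwillLemma3Halasz
import HarnessLib

/-!
# Halász's theorem for block-restricted sums, IV: the Dirichlet polynomial on the `1`-line

Topic `Literature/NumberTheory/LFunctions`.  Everything in this file is PROVED; no definitions, no named facts.

`Halasz.Restricted.norm_restr_sum_le` (`HalaszRestricted.lean`) bounds the sharp sums `∑_{n ≤ x, n ∈ 𝒮} g(n)`
of a completely multiplicative `1`-bounded `g` restricted to `𝒮` = {integers with a prime factor in every block}.
The object of Matomäki–Radziwiłł–Tao 2015, Proposition A.3 is the restricted Dirichlet polynomial on the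
`1`-line, `F(1+it) = ∑_{X ≤ n ≤ 2X, n ∈ 𝒮} f(n) n^{-1-it}` (`MRT2015.restrDirichlet`), and the cofactor sums of
Matomäki–Radziwiłł 2016, §8 are of the same dyadic, `1/n`-weighted shape.  This file performs the two
routine steps from the former to the latter — twisting by `n^{-it}` and partial summation — once:

* `Halasz.Restricted.isBlockSystem_mono_N` — a block system for the height `N` is one for every `N' ≥ N`;
* `Halasz.Restricted.twist_mul`, `…twist_one` — `n ↦ g(n) n^{-it}` is completely multiplicative and takes
  the value `1` at `1` (it is `1`-bounded by `norm_mul_twist_le` of `HalaszRestrictedOffMinimiser.lean`);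
* `Halasz.Restricted.sum_range_restrTwist_eq_S` — the partial sums `∑_{i < k} c(i)` of
  `c(n) = g(n) n^{-it} 1_𝒮(n)` (`c(0) = 0`) are the `S(restr …)(k - 1)` of `norm_restr_sum_le`;
* `Halasz.Restricted.norm_restr_dirichlet_le` — **the dyadic `1`-line bound**: an absolute `K` with
  `‖∑_{⌈X⌉ ≤ n ≤ ⌊2X⌋, n ∈ 𝒮} g(n) n^{-(1+it)}‖ ≤ K ((1 + M₀) e^{-M₀} + 1/T + (|𝓙| + 1) √((log Q + 2)/log X))`
  for `X ≥ 4`, `T ≥ 4`, `Q ≥ e²`, blocks of primes `≤ min(⌈X⌉ - 1, Q)`, and any `0 ≤ M₀` with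
  `M₀ ≤ M_½(g n^{-it}; y, T)` (`minHalfDistSq` of the twisted function) at all heights `X - 1 ≤ y ≤ 2X`
  (by `halfDistSq_mul_twist` this is `min_{|u| ≤ T} 𝔻_½(g, n^{i(t+u)}; y)²`);
  partial summation is `Sieve.MatomakiRadziwillL3.norm_sum_div_le_of_partial`.

## References
* K. Matomäki, M. Radziwiłł, T. Tao, Algebra & Number Theory 9 (2015), Appendix A, proof of Proposition A.3
  ("by Halász's theorem, for every `|t| ≤ T`, `F(1+it) ≪ …`"). [cite: MatomakiRadziwillTao2015, Appendix A, Proposition A.3 (proof)]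
* K. Matomäki, M. Radziwiłł, Ann. of Math. 183 (2016), Lemma 1 ("Halász's theorem … and partial summation").
  [cite: MatomakiRadziwillAnnals2016, Lemma 1]
-/

noncomputable section

open Finset Real Complex
open scoped ComplexConjugate Classical

namespace Literature.NumberTheory.LFunctions

namespace Halasz

namespace Restricted

variable {ι : Type*} {𝓙 : Finset ι} {blk : ι → Finset ℕ} {g : ℕ → ℂ}

/-! ### Block systems at larger heights -/

/-- A block system of primes `≤ N` is a block system of primes `≤ N'` for every `N' ≥ N`. [folklore] -/
theorem isBlockSystem_mono_N {N N' : ℕ} (h : IsBlockSystem 𝓙 blk N) (hN : N ≤ N') : IsBlockSystem 𝓙 blk N' := by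
  refine ⟨fun i hi p hp => ?_, h.disjoint⟩
  have := Nat.mem_primesBelow.mp (h.subset i hi hp)
  exact Nat.mem_primesBelow.mpr ⟨by omega, this.2⟩

/-! ### The twisted function `n ↦ g(n) n^{-it}` -/

/-- The twist of a completely multiplicative `g` by `n^{-it}` is completely multiplicative. [folklore] -/
theorem twist_mul (hg : ∀ m n, g (m * n) = g m * g n) (t : ℝ) :
    ∀ m n : ℕ, (fun k : ℕ => g k * (k : ℂ) ^ (-((t : ℂ) * I))) (m * n) =
      (fun k : ℕ => g k * (k : ℂ) ^ (-((t : ℂ) * I))) m * (fun k : ℕ => g k * (k : ℂ) ^ (-((t : ℂ) * I))) n := by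
  intro m n
  dsimp only
  rw [hg, Sieve.MatomakiRadziwillL4A.natCast_mul_cpow]
  ring

/-- … and takes the value `1` at `1` (and it is `1`-bounded: `norm_mul_twist_le`). [folklore] -/
theorem twist_one (hg1 : g 1 = 1) (t : ℝ) : (fun k : ℕ => g k * (k : ℂ) ^ (-((t : ℂ) * I))) 1 = 1 := by
  simp [hg1]

/-! ### The coefficients `c(n) = g(n) n^{-it} 1_𝒮(n)` and their partial sums -/

/-- For `1 ≤ n ≤ N`: `restr 𝓙 blk h N n = h n · 1_𝒮(n)`. [folklore] -/
theorem restr_eq_of_le {h : ℕ → ℂ} {N n : ℕ} (hn1 : 1 ≤ n) (hnN : n ≤ N) :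
    restr 𝓙 blk h N n = h n * blockInd 𝓙 blk n := by
  unfold restr
  rw [smoothCut_eq_self hn1 hnN]

/-- **Partial sums**: with `c(n) = h(n) 1_𝒮(n)` for `n ≥ 1` and `c(0) = 0`,
`∑_{i < k} c(i) = S(restr 𝓙 blk h (k-1))(k-1)`. [folklore] -/
theorem sum_range_restrTwist_eq_S (h : ℕ → ℂ) (k : ℕ) :
    ∑ i ∈ Finset.range k, (if i = 0 then 0 else h i * blockInd 𝓙 blk i) =
      S (restr 𝓙 blk h (k - 1)) ((k - 1 : ℕ) : ℝ) := by
  unfold S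
  rw [Nat.floor_natCast]
  rcases Nat.eq_zero_or_pos k with rfl | hk
  · simp
  · have hrange : Finset.range k = insert 0 (Finset.Icc 1 (k - 1)) := by
      ext i; simp only [Finset.mem_range, Finset.mem_insert, Finset.mem_Icc]; omega
    rw [hrange, Finset.sum_insert (by simp), if_pos rfl, zero_add]
    refine Finset.sum_congr rfl fun i hi => ?_
    rw [Finset.mem_Icc] at hi
    rw [if_neg (by omega), restr_eq_of_le hi.1 hi.2]

/-- The dyadic `1`-line sum in terms of `c`: for `a ≥ 1`,
`∑_{a ≤ n ≤ b, n ∈ 𝒮} g(n) n^{-(1+it)} = ∑_{a ≤ n ≤ b} c(n)/n` with `c(n) = g(n) n^{-it} 1_𝒮(n)`. [folklore] -/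
theorem sum_filter_memBlocks_eq_sum_div {a b : ℕ} (ha : 1 ≤ a) (t : ℝ) :
    ∑ n ∈ (Finset.Icc a b).filter (MemBlocks 𝓙 blk), g n * (n : ℂ) ^ (-(1 + (t : ℂ) * I)) =
      ∑ n ∈ Finset.Icc a b,
        (if n = 0 then 0 else (g n * (n : ℂ) ^ (-((t : ℂ) * I))) * blockInd 𝓙 blk n) / n := by
  classical
  rw [Finset.sum_filter]
  refine Finset.sum_congr rfl fun n hn => ?_
  rw [Finset.mem_Icc] at hn
  have hn0 : n ≠ 0 := by omega
  have hnC : (n : ℂ) ≠ 0 := by exact_mod_cast hn0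
  rw [if_neg hn0]
  unfold blockInd
  split_ifs with hmem
  · rw [mul_one, neg_add, Complex.cpow_add _ _ hnC, Complex.cpow_neg_one]
    field_simp
  · simp

/-! ### The dyadic `1`-line bound -/

set_option maxHeartbeats 800000 in
/-- **Halász for block-restricted sums on the `1`-line, dyadic form.**  There is an absolute `K > 0` such that
for every completely multiplicative `g` with `|g| ≤ 1`, real `t`, `X ≥ 4`, `T ≥ 4`, `Q ≥ e²`, every block
system of primes `≤ min(⌈X⌉ - 1, Q)` (`IsBlockSystem 𝓙 blk (⌈X⌉₊ - 1)`), and every `M₀ ≥ 0` with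
`M₀ ≤ M_½(g · n^{-it}; y, T)` for all `X - 1 ≤ y ≤ 2X`,
`‖∑_{⌈X⌉ ≤ n ≤ ⌊2X⌋, n ∈ 𝒮} g(n) n^{-(1+it)}‖ ≤ K ((1 + M₀) e^{-M₀} + 1/T + (|𝓙| + 1) √((log Q + 2)/log X))`.
Proof: `norm_restr_sum_le` for the twisted function at each height `k - 1 ∈ [⌈X⌉ - 1, ⌊2X⌋]`
(`(1+M)e^{-M}` is antitone, `log(k-1) ≥ log(X-1) ≥ (log X)/2`), then
`Sieve.MatomakiRadziwillL3.norm_sum_div_le_of_partial`. [cite: MatomakiRadziwillTao2015, Appendix A, Proposition A.3 (proof)] -/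
theorem norm_restr_dirichlet_le :
    ∃ K : ℝ, 0 < K ∧ ∀ (𝓙 : Finset ℕ) (blk : ℕ → Finset ℕ) (g : ℕ → ℂ),
      (∀ m n, g (m * n) = g m * g n) → g 1 = 1 → (∀ n, ‖g n‖ ≤ 1) →
      ∀ t X T Q M₀ : ℝ, 4 ≤ X → 4 ≤ T → Real.exp 2 ≤ Q → IsBlockSystem 𝓙 blk (⌈X⌉₊ - 1) →
      (∀ i ∈ 𝓙, ∀ p ∈ blk i, (p : ℝ) ≤ Q) → 0 ≤ M₀ →
      (∀ y : ℝ, X - 1 ≤ y → y ≤ 2 * X →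
        M₀ ≤ minHalfDistSq (𝓙.biUnion blk) (fun n : ℕ => g n * (n : ℂ) ^ (-((t : ℂ) * I))) y T) →
        ‖∑ n ∈ (Finset.Icc ⌈X⌉₊ ⌊2 * X⌋₊).filter (MemBlocks 𝓙 blk), g n * (n : ℂ) ^ (-(1 + (t : ℂ) * I))‖ ≤
          K * ((1 + M₀) * Real.exp (-M₀) + 1 / T + (𝓙.card + 1) * Real.sqrt ((Real.log Q + 2) / Real.log X)) := by
  classical
  obtain ⟨K, hK, hH⟩ := norm_restr_sum_le
  refine ⟨9 * K, by positivity, ?_⟩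
  intro 𝓙 blk g hg hg1 hgb t X T Q M₀ hX hT hQ hsys hblkQ hM₀0 hM₀
  set gt : ℕ → ℂ := fun k => g k * (k : ℂ) ^ (-((t : ℂ) * I)) with hgt
  have hgt_mul : ∀ m n, gt (m * n) = gt m * gt n := twist_mul hg t
  have hgt_one : gt 1 = 1 := twist_one hg1 t
  have hgt_b : ∀ n, ‖gt n‖ ≤ 1 := norm_mul_twist_le hgb t
  set c : ℕ → ℂ := fun n => if n = 0 then 0 else gt n * blockInd 𝓙 blk n with hc
  -- the range
  set a : ℕ := ⌈X⌉₊ with ha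
  set b : ℕ := ⌊2 * X⌋₊ with hb
  have hX0 : 0 < X := by linarith
  have haX : X ≤ a := Nat.le_ceil X
  have haX1 : (a : ℝ) < X + 1 := Nat.ceil_lt_add_one hX0.le
  have hbX : (b : ℝ) ≤ 2 * X := Nat.floor_le (by linarith)
  have hbX1 : 2 * X < b + 1 := Nat.lt_floor_add_one _
  have ha4 : 4 ≤ a := by
    have : (4 : ℝ) ≤ a := hX.trans haX
    exact_mod_cast this
  have hab : a ≤ b := by
    have : (a : ℝ) < b + 1 := by linarith
    have : a < b + 1 := by exact_mod_cast this
    omega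
  have ha1 : 1 ≤ a := by omega
  -- the uniform bound for the error bracket at heights `y ∈ [X-1, 2X]`
  set Bnd : ℝ := (1 + M₀) * Real.exp (-M₀) + 1 / T +
    (𝓙.card + 1) * Real.sqrt ((Real.log Q + 2) / Real.log (X - 1)) with hBnd
  have hlogX1 : 0 < Real.log (X - 1) := Real.log_pos (by linarith)
  have hlogX : 0 < Real.log X := Real.log_pos (by linarith)
  have hQ2 : 0 ≤ Real.log Q + 2 := by
    have : 0 ≤ Real.log Q := Real.log_nonneg (le_trans (Real.one_le_exp (by norm_num)) hQ)
    linarith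
  have hBnd0 : 0 ≤ Bnd := by positivity
  -- partial sums
  have hpart : ∀ k, a ≤ k → k ≤ b + 1 → ‖∑ i ∈ Finset.range k, c i‖ ≤ 2 * X * (K * Bnd) := by
    intro k hk hkb
    rw [hc, sum_range_restrTwist_eq_S]
    set y : ℝ := ((k - 1 : ℕ) : ℝ) with hy
    have hk1 : a - 1 ≤ k - 1 := by omega
    have hyX : X - 1 ≤ y := by
      have hak : (a : ℝ) ≤ k := by exact_mod_cast (by omega : a ≤ k)
      have hy' : y = (k : ℝ) - 1 := by
        rw [hy, Nat.cast_sub (by omega : 1 ≤ k)]; push_cast; ring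
      rw [hy']; linarith
    have hy2X : y ≤ 2 * X := by
      have : y ≤ b := by rw [hy]; exact_mod_cast (by omega : k - 1 ≤ b)
      linarith
    have hy3 : 3 ≤ y := by linarith
    have hy0 : 0 < y := by linarith
    have hfloor : ⌊y⌋₊ = k - 1 := by rw [hy, Nat.floor_natCast]
    have hsys' : IsBlockSystem 𝓙 blk ⌊y⌋₊ := by
      rw [hfloor]; exact isBlockSystem_mono_N hsys (by omega)
    have h := hH 𝓙 blk gt hgt_mul hgt_one hgt_b y T Q hy3 hT hQ hsys' hblkQ
    rw [hfloor] at h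
    refine h.trans ?_
    -- compare the bracket with `Bnd`
    have hMy : M₀ ≤ minHalfDistSq (𝓙.biUnion blk) gt y T := hM₀ y hyX hy2X
    have h1 : (1 + minHalfDistSq (𝓙.biUnion blk) gt y T) * Real.exp (-minHalfDistSq (𝓙.biUnion blk) gt y T) ≤
        (1 + M₀) * Real.exp (-M₀) := Tao2016.one_add_mul_exp_neg_le hM₀0 hMy
    have h2 : Real.sqrt ((Real.log Q + 2) / Real.log y) ≤ Real.sqrt ((Real.log Q + 2) / Real.log (X - 1)) := by
      refine Real.sqrt_le_sqrt (div_le_div_of_nonneg_left hQ2 hlogX1 ?_)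
      exact Real.log_le_log (by linarith) hyX
    have h3 : (1 + minHalfDistSq (𝓙.biUnion blk) gt y T) * Real.exp (-minHalfDistSq (𝓙.biUnion blk) gt y T) + 1 / T +
        (𝓙.card + 1) * Real.sqrt ((Real.log Q + 2) / Real.log y) ≤ Bnd := by
      rw [hBnd]
      have : (𝓙.card + 1 : ℝ) * Real.sqrt ((Real.log Q + 2) / Real.log y) ≤
          (𝓙.card + 1) * Real.sqrt ((Real.log Q + 2) / Real.log (X - 1)) :=
        mul_le_mul_of_nonneg_left h2 (by positivity)
      linarith
    calc K * y * ((1 + minHalfDistSq (𝓙.biUnion blk) gt y T) * Real.exp (-minHalfDistSq (𝓙.biUnion blk) gt y T) +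
          1 / T + (𝓙.card + 1) * Real.sqrt ((Real.log Q + 2) / Real.log y))
        ≤ K * y * Bnd := mul_le_mul_of_nonneg_left h3 (by positivity)
      _ ≤ K * (2 * X) * Bnd := by gcongr
      _ = 2 * X * (K * Bnd) := by ring
  -- partial summation
  have hsum := Sieve.MatomakiRadziwillL3.norm_sum_div_le_of_partial (g := c) ha1 hab hpart
  rw [sum_filter_memBlocks_eq_sum_div ha1 t]
  refine hsum.trans ?_
  -- `3 · 2X K Bnd / a ≤ 6 K Bnd ≤ 9 K Bnd'`
  have haR : (0 : ℝ) < a := by exact_mod_cast (by omega : 0 < a)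
  have hstep1 : 3 * (2 * X * (K * Bnd)) / a ≤ 6 * (K * Bnd) := by
    rw [div_le_iff₀ haR]
    have : 0 ≤ K * Bnd := by positivity
    nlinarith
  refine hstep1.trans ?_
  -- `√((log Q + 2)/log(X-1)) ≤ √2 √((log Q + 2)/log X)` since `log(X-1) ≥ (log X)/2`
  have hlog2 : Real.log X / 2 ≤ Real.log (X - 1) := by
    -- `X - 1 ≥ √X` for `X ≥ 4` (`(X-1)² - X = X² - 3X + 1 ≥ 0`)
    have hsq : Real.sqrt X ≤ X - 1 := by
      rw [Real.sqrt_le_left (by linarith)]; nlinarith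
    have := Real.log_le_log (Real.sqrt_pos.2 hX0) hsq
    rw [Real.log_sqrt hX0.le] at this
    linarith
  have hsqrt : Real.sqrt ((Real.log Q + 2) / Real.log (X - 1)) ≤
      Real.sqrt 2 * Real.sqrt ((Real.log Q + 2) / Real.log X) := by
    rw [← Real.sqrt_mul (by norm_num)]
    refine Real.sqrt_le_sqrt ?_
    rw [div_le_iff₀ hlogX1]
    calc Real.log Q + 2 = 2 * ((Real.log Q + 2) / Real.log X) * (Real.log X / 2) := by field_simp
      _ ≤ 2 * ((Real.log Q + 2) / Real.log X) * Real.log (X - 1) :=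
          mul_le_mul_of_nonneg_left hlog2 (by positivity)
  have hsqrt2 : Real.sqrt 2 ≤ 3 / 2 := by
    rw [Real.sqrt_le_left (by norm_num)]; norm_num
  have hBndle : Bnd ≤ (3 / 2) * ((1 + M₀) * Real.exp (-M₀) + 1 / T +
      (𝓙.card + 1) * Real.sqrt ((Real.log Q + 2) / Real.log X)) := by
    rw [hBnd]
    have hA : 0 ≤ (1 + M₀) * Real.exp (-M₀) + 1 / T := by positivity
    have hS0 : 0 ≤ Real.sqrt ((Real.log Q + 2) / Real.log X) := Real.sqrt_nonneg _
    have hcard : (0 : ℝ) ≤ 𝓙.card + 1 := by positivity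
    have : (𝓙.card + 1 : ℝ) * Real.sqrt ((Real.log Q + 2) / Real.log (X - 1)) ≤
        (𝓙.card + 1) * ((3 / 2) * Real.sqrt ((Real.log Q + 2) / Real.log X)) := by
      refine mul_le_mul_of_nonneg_left (hsqrt.trans ?_) hcard
      exact mul_le_mul_of_nonneg_right hsqrt2 hS0
    nlinarith
  calc 6 * (K * Bnd) ≤ 6 * (K * ((3 / 2) * ((1 + M₀) * Real.exp (-M₀) + 1 / T +
        (𝓙.card + 1) * Real.sqrt ((Real.log Q + 2) / Real.log X)))) := by
        gcongr
    _ = 9 * K * ((1 + M₀) * Real.exp (-M₀) + 1 / T +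
        (𝓙.card + 1) * Real.sqrt ((Real.log Q + 2) / Real.log X)) := by ring

end Restricted

end Halasz

end Literature.NumberTheory.LFunctions

end
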